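/-
Fleet lead `ym-wcr-19609-p1` (seat prover-ym-wcr-19609-p1-g2-0), route `WeakCouplingRates`, crux `BulkDominatesColdBoxW`
(stmt-QuantumFields-19609), line `dlr-chessboard` (v4): the kernel-checked REDUCTION of stub L1b (census v3, item evidence #12).
-/
import Summits.QuantumFields.YangMills.Theorems.WeakCouplingRatesBulkDominatesColdBoxWDatumBackgroundInterior
import Summits.QuantumFields.YangMills.Theorems.WeakCouplingRatesBulkDominatesColdBoxWDefs
import Summits.QuantumFields.YangMills.Theorems.WeakCouplingRatesColdBoxTwoPointFloorWStubBoxKernelVsLattice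

/-!
# Crux `BulkDominatesColdBoxW`: stub L1b `stub_goodBoundaryMeanSmooth` REDUCED to the one-scale kernel mean expansion (N2) and the
# flatness of the Dirichlet variance (N1') — the exponent bookkeeping of census v3 §3, kernel-checked

For every `θ` below a ceiling, along the registered family `(A, δ) = (θ/20, θ/5)`: IF (N2, mean form) the deep kernel means of the
`(1,2)`-plaquette cost expand, uniformly over crude-good data `ω`, as `β·E_ω[c_q] = (3/2)·V_D(q) + β·Σ_c F̄_c(q)² ± β^{−θ}` at every base
point within `H/8` of the centre, with one-colour Dirichlet data `ϑ c` and competitors of total energy `≤ 16(2H+3)⁴β^{2δ−1}`, and IF (N1')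
the D1' variance is flat near the centre, `|V_D(q) − V_D(q')| ≤ K_N/H`, THEN `GoodBoundaryMeanSmooth (θ/20) θ (θ/5)`:
`|E_ω c_{p+Te₀} − E_ω c_p| ≤ K·β^{2δ−1}·T/H` with `K = 4 + (3/2)|K_N| + 20000·C²` (`C` = the interior-estimate constant of
`dirBackground_interior_bounds`).  The background term is telescoped over the `T` unit steps from the centre; each step is
`|F̄_c(x+e₀)² − F̄_c(x)²| ≤ (C√E_c/H³)·(2C√E_c/H²)` by the interior sup and GRADIENT bounds — this is where the registered shape `T/H` comes
from — and `(2H+3)⁴ ≤ 625 H⁴`; the expansion errors `2β^{−θ}` and the flatness `(3/2)K_N/H` are absorbed by `β^{2δ}T/H ≥ β^{−θ}/2`.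
This file states the reduction with the two interfaces UNFOLDED (so that it does not wait for their named forms
`KernelMeanExpansion` / `DirKernelDiagFlat` of `…BulkDominatesColdBoxWDefs.lean`, appended separately); the named corollary is one line.
No new definition; standard axioms.  NOT a claim about the mass gap.
-/

set_option autoImplicit false

noncomputable section

open MeasureTheory Finset Matrix
open Literature.Probability.LatticeModels
open Literature.MathematicalPhysics.QuantumLattice
open Literature.MathematicalPhysics.QuantumFieldTheory
open Literature.MathematicalPhysics.QuantumFieldTheory.LatticeMaxwell
open Literature.MathematicalPhysics.QuantumFieldTheory.AxialGauge
open Literature.MathematicalPhysics.QuantumFieldTheory.LatticeChain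
open Literature.MathematicalPhysics.QuantumFieldTheory.LatticeForm (e d₁ d₁_swap)

namespace Summit.QuantumFields.YangMills.Theorems.WeakCouplingRates

/-! ## Small arithmetic helpers -/

/-- `|b² − a²| ≤ Q·(2P)` when `|a|, |b| ≤ P` and `|b − a| ≤ Q`. -/
theorem abs_sq_sub_sq_le {a b P Q : ℝ} (ha : |a| ≤ P) (hb : |b| ≤ P) (hab : |b - a| ≤ Q) :
    |b ^ 2 - a ^ 2| ≤ Q * (2 * P) := by
  have hQ : 0 ≤ Q := (abs_nonneg _).trans hab
  rw [show b ^ 2 - a ^ 2 = (b - a) * (b + a) by ring, abs_mul]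
  exact mul_le_mul hab ((abs_add_le _ _).trans (by linarith)) (abs_nonneg _) hQ

/-- The points `centre + t·e₀`, `t ≤ T`, are within `H/8` of the centre when `8T ≤ H`. -/
theorem near_centre_of_le {H T t : ℕ} (hT : 8 * T ≤ H) (ht : t ≤ T) (m : Fin 4) :
    8 * |(boxCentre H + Pi.single 0 (t : ℤ) : Site 4) m - (H : ℤ)| ≤ (H : ℤ) := by
  simp only [Pi.add_apply, boxCentre, Pi.single_apply]
  split_ifs
  · rw [add_sub_cancel_left, abs_of_nonneg (by positivity)]; omega
  · simp

/-- `(2H+3)⁴ ≤ 625·H⁴` for `H ≥ 1`. -/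
theorem two_mul_add_three_pow_four_le {H : ℝ} (hH : 1 ≤ H) : (2 * H + 3) ^ 4 ≤ 625 * H ^ 4 := by
  have h : 2 * H + 3 ≤ 5 * H := by linarith
  have h0 : 0 ≤ 2 * H + 3 := by linarith
  calc (2 * H + 3) ^ 4 ≤ (5 * H) ^ 4 := pow_le_pow_left₀ h0 h 4
    _ = 625 * H ^ 4 := by ring

/-! ## The reduction -/

/-- **L1b ⇐ N2 (mean expansion) ∧ N1' (flat Dirichlet variance)**, with both interfaces unfolded; see the module docstring. -/
theorem goodBoundaryMeanSmooth_of_expansion_explicit {θ₂ : ℝ} (hθ₂ : 0 < θ₂)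
    (hexp : ∀ θ : ℝ, 0 < θ → θ ≤ θ₂ →
      ∃ β₀ : ℝ, ∀ β : ℝ, β₀ ≤ β → ∀ ω : LGConfig 4 (Matrix.specialUnitaryGroup (Fin 2) ℂ), CrudeGood β (θ / 5) ⌈β ^ θ⌉₊ ω →
        ∃ ϑ : Fin 3 → (Literature.MathematicalPhysics.QuantumLattice.ZdEdge 4 → ℝ), ∃ s : Fin 3 → (DirFree ⌈β ^ θ⌉₊ → ℝ),
          (∑ c, LatticeMaxwell.formM (fun e => e ∉ dirFreeEdges ⌈β ^ θ⌉₊) dirCorner (2 * ⌈β ^ θ⌉₊ + 3) (ϑ c) (s c) ≤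
              16 * (2 * (⌈β ^ θ⌉₊ : ℝ) + 3) ^ 4 * β ^ (2 * (θ / 5) - 1)) ∧
          ∀ x : Site 4, (∀ m : Fin 4, 8 * |x m - (⌈β ^ θ⌉₊ : ℤ)| ≤ (⌈β ^ θ⌉₊ : ℤ)) →
            |β * (∫ U, plaqCostAt (fundamentalRep (Fin 2)) x 1 2 U ∂(boxKernel β ⌈β ^ θ⌉₊ ω)) -
                3 / 2 * boxDirProjKernel ⌈β ^ θ⌉₊ (x, 1, 2) (x, 1, 2) -
                β * ∑ c, LatticeMaxwell.sCirc (LatticeMaxwell.glue (pin := fun e => e ∉ dirFreeEdges ⌈β ^ θ⌉₊) dirCorner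
                  (2 * ⌈β ^ θ⌉₊ + 3) (ϑ c) (LatticeMaxwell.mean (fun e => e ∉ dirFreeEdges ⌈β ^ θ⌉₊) dirCorner (2 * ⌈β ^ θ⌉₊ + 3)
                    (ϑ c))) (x, 1, 2) ^ 2| ≤ β ^ (-θ))
    (hflat : ∃ K : ℝ, ∃ H₀ : ℕ, ∀ H : ℕ, H₀ ≤ H → ∀ x x' : Site 4,
      (∀ m : Fin 4, 8 * |x m - (H : ℤ)| ≤ (H : ℤ)) → (∀ m : Fin 4, 8 * |x' m - (H : ℤ)| ≤ (H : ℤ)) →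
        |boxDirProjKernel H (x, 1, 2) (x, 1, 2) - boxDirProjKernel H (x', 1, 2) (x', 1, 2)| ≤ K / H) :
    ∃ θ₁ : ℝ, 0 < θ₁ ∧ ∀ θ : ℝ, 0 < θ → θ ≤ θ₁ → GoodBoundaryMeanSmooth (θ / 20) θ (θ / 5) := by
  obtain ⟨KN, H₀, hN⟩ := hflat
  obtain ⟨C, hC0, hI⟩ := dirBackground_interior_bounds
  refine ⟨θ₂, hθ₂, fun θ hθ hθle => ?_⟩
  obtain ⟨β₁, hE⟩ := hexp θ hθ hθle
  set A : ℝ := θ / 20 with hA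
  set δ : ℝ := θ / 5 with hδ
  have hA0 : 0 < A := by rw [hA]; positivity
  have hAθ : 0 < θ - A := by rw [hA]; linarith
  -- thresholds: β ≥ β₁, β ≥ 1, β^θ ≥ max H₀ 8, β^{θ−A} ≥ 16
  set N₀ : ℝ := max (H₀ : ℝ) 8 with hN₀
  refine ⟨4 + 3 / 2 * |KN| + 20000 * C ^ 2,
    max (max β₁ 1) (max (N₀ ^ (1 / θ)) ((16 : ℝ) ^ (1 / (θ - A)))), fun β hβ ω hω => ?_⟩
  have hβ₁ : β₁ ≤ β := le_trans (le_trans (le_max_left _ _) (le_max_left _ _)) hβ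
  have hβ1 : (1 : ℝ) ≤ β := le_trans (le_trans (le_max_right _ _) (le_max_left _ _)) hβ
  have hβ0 : 0 < β := by linarith
  have hN₀β : N₀ ≤ β ^ θ :=
    le_rpow_of_root_le (by rw [hN₀]; positivity) hθ (le_trans (le_trans (le_max_left _ _) (le_max_right _ _)) hβ)
  have h16 : (16 : ℝ) ≤ β ^ (θ - A) :=
    le_rpow_of_root_le (by norm_num) hAθ (le_trans (le_trans (le_max_right _ _) (le_max_right _ _)) hβ)
  set H : ℕ := ⌈β ^ θ⌉₊ with hHdef
  set T : ℕ := ⌈β ^ A⌉₊ with hTdef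
  obtain ⟨hT1, hT2⟩ := one_le_ceil_rpow_and_le hβ1 hA0.le
  obtain ⟨hH1, hH2⟩ := one_le_ceil_rpow_and_le hβ1 hθ.le
  rw [← hTdef] at hT1 hT2
  rw [← hHdef] at hH1 hH2
  have hHceil : β ^ θ ≤ (H : ℝ) := Nat.le_ceil _
  have hH8 : 8 ≤ H := by
    have : (8 : ℝ) ≤ H := le_trans (le_trans (le_max_right _ _) hN₀β) hHceil
    exact_mod_cast this
  have hHH₀ : H₀ ≤ H := by
    have : (H₀ : ℝ) ≤ H := le_trans (le_trans (le_max_left _ _) hN₀β) hHceil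
    exact_mod_cast this
  have hHpos : (0 : ℝ) < H := by linarith
  have hH1' : (1 : ℝ) ≤ H := hH1
  -- `8T ≤ H`
  have h8T : 8 * T ≤ H := by
    have h1 : (8 : ℝ) * T ≤ 16 * β ^ A := by linarith
    have h2 : (16 : ℝ) * β ^ A ≤ β ^ θ := by
      have : β ^ θ = β ^ (θ - A) * β ^ A := by
        rw [← Real.rpow_add hβ0]; ring_nf
      rw [this]
      exact mul_le_mul_of_nonneg_right h16 (Real.rpow_nonneg hβ0.le _)
    have : (8 : ℝ) * T ≤ H := h1.trans (h2.trans hHceil)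
    exact_mod_cast this
  -- the expansion data for this `β`, `ω`
  obtain ⟨ϑ, s, henergy, hpt⟩ := hE β hβ₁ ω hω
  -- notation
  set pin : Literature.MathematicalPhysics.QuantumLattice.ZdEdge 4 → Prop := fun e => e ∉ dirFreeEdges H with hpin
  set Fb : Fin 3 → Site 4 → ℝ := fun c x =>
    LatticeMaxwell.sCirc (LatticeMaxwell.glue (pin := pin) dirCorner (2 * H + 3) (ϑ c)
      (LatticeMaxwell.mean pin dirCorner (2 * H + 3) (ϑ c))) (x, 1, 2) with hFb
  set Ec : Fin 3 → ℝ := fun c => LatticeMaxwell.formM pin dirCorner (2 * H + 3) (ϑ c) (s c) with hEc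
  set xt : ℕ → Site 4 := fun t => boxCentre H + Pi.single 0 (t : ℤ) with hxt
  set Em : ℕ → ℝ := fun t => ∫ U, plaqCostAt (fundamentalRep (Fin 2)) (xt t) 1 2 U ∂(boxKernel β H ω) with hEm
  set Vt : ℕ → ℝ := fun t => boxDirProjKernel H (xt t, 1, 2) (xt t, 1, 2) with hVt
  set Bt : ℕ → ℝ := fun t => ∑ c, Fb c (xt t) ^ 2 with hBt
  have hEc0 : ∀ c, 0 ≤ Ec c := fun c => by
    rw [hEc]; simp only [LatticeMaxwell.formM]; exact Finset.sum_nonneg fun p _ => sq_nonneg _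
  have hnear : ∀ t : ℕ, t ≤ T → ∀ m : Fin 4, 8 * |xt t m - (H : ℤ)| ≤ (H : ℤ) := fun t ht m => near_centre_of_le h8T ht m
  -- the expansion at the points `xt t`, `t ≤ T`
  have hexp_t : ∀ t : ℕ, t ≤ T → |β * Em t - 3 / 2 * Vt t - β * Bt t| ≤ β ^ (-θ) := fun t ht => hpt (xt t) (hnear t ht)
  -- interior bounds for each colour at the points `xt t`
  have hFb_d₁ : ∀ c x, Fb c x = d₁ (fun z (i : Fin 4) =>
      LatticeMaxwell.glue (pin := pin) dirCorner (2 * H + 3) (ϑ c) (LatticeMaxwell.mean pin dirCorner (2 * H + 3) (ϑ c)) (z, i))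
        x 1 2 := fun c x => by rw [hFb]; exact sCirc_eq_d₁ _ _
  have hsup : ∀ c (t : ℕ), t ≤ T → |Fb c (xt t)| ≤ C * Real.sqrt (Ec c) / (H : ℝ) ^ 2 := by
    intro c t ht
    rw [hFb_d₁]
    exact (hI H hH8 (ϑ c) (s c) (xt t) (hnear t ht) 1 2).1
  have hgrad : ∀ c (t : ℕ), t + 1 ≤ T → |Fb c (xt (t + 1)) - Fb c (xt t)| ≤ C * Real.sqrt (Ec c) / (H : ℝ) ^ 3 := by
    intro c t ht
    have h := (hI H hH8 (ϑ c) (s c) (xt t) (hnear t (by omega)) 1 2).2 0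
    have hx : xt (t + 1) = xt t + Pi.single 0 1 := by
      show boxCentre H + Pi.single 0 (((t + 1 : ℕ) : ℤ)) = boxCentre H + Pi.single 0 (t : ℤ) + Pi.single 0 1
      rw [Nat.cast_succ, Pi.single_add, add_assoc]
    rw [hFb_d₁, hFb_d₁, hx]
    exact h
  -- per-step bound on the background term
  have hstep : ∀ t : ℕ, t + 1 ≤ T → |Bt (t + 1) - Bt t| ≤ 2 * C ^ 2 * (∑ c, Ec c) / (H : ℝ) ^ 5 := by
    intro t ht
    rw [hBt]
    simp only
    rw [← Finset.sum_sub_distrib, Finset.mul_sum, Finset.sum_div]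
    refine (Finset.abs_sum_le_sum_abs _ _).trans (Finset.sum_le_sum fun c _ => ?_)
    have h1 := hsup c t (by omega)
    have h2 := hsup c (t + 1) ht
    have h3 := hgrad c t ht
    have hs : Real.sqrt (Ec c) * Real.sqrt (Ec c) = Ec c := Real.mul_self_sqrt (hEc0 c)
    set r := Real.sqrt (Ec c) with hr
    refine (abs_sq_sub_sq_le h1 h2 h3).trans (le_of_eq ?_)
    rw [← hs]
    field_simp
  -- telescope
  have htel : |Bt T - Bt 0| ≤ (T : ℝ) * (2 * C ^ 2 * (∑ c, Ec c) / (H : ℝ) ^ 5) := by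
    rw [← Finset.sum_range_sub Bt T]
    refine (Finset.abs_sum_le_sum_abs _ _).trans ?_
    calc ∑ i ∈ Finset.range T, |Bt (i + 1) - Bt i| ≤ ∑ _i ∈ Finset.range T, 2 * C ^ 2 * (∑ c, Ec c) / (H : ℝ) ^ 5 :=
          Finset.sum_le_sum fun i hi => hstep i (by have := Finset.mem_range.1 hi; omega)
      _ = (T : ℝ) * (2 * C ^ 2 * (∑ c, Ec c) / (H : ℝ) ^ 5) := by rw [Finset.sum_const, Finset.card_range, nsmul_eq_mul]
  -- energy and geometry
  have hEsum : ∑ c, Ec c ≤ 16 * (2 * (H : ℝ) + 3) ^ 4 * β ^ (2 * δ - 1) := henergy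
  have hgeo : (2 * (H : ℝ) + 3) ^ 4 ≤ 625 * (H : ℝ) ^ 4 := two_mul_add_three_pow_four_le hH1'
  have hβpow : 0 < β ^ (2 * δ - 1) := Real.rpow_pos_of_pos hβ0 _
  have hH0 : (H : ℝ) ≠ 0 := hHpos.ne'
  have hback : β * |Bt T - Bt 0| ≤ 20000 * C ^ 2 * (β ^ (2 * δ) * T / H) := by
    have h2δ : β ^ (2 * δ) = β * β ^ (2 * δ - 1) := by
      rw [show 2 * δ = 1 + (2 * δ - 1) by ring, Real.rpow_add hβ0, Real.rpow_one]; ring_nf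
    rw [h2δ]
    have hT0 : (0 : ℝ) ≤ T := by positivity
    have hE' : ∑ c, Ec c ≤ 16 * (625 * (H : ℝ) ^ 4) * β ^ (2 * δ - 1) :=
      hEsum.trans (by gcongr)
    have hfrac : 2 * C ^ 2 * (∑ c, Ec c) / (H : ℝ) ^ 5 ≤ 20000 * C ^ 2 * β ^ (2 * δ - 1) / (H : ℝ) := by
      rw [div_le_div_iff₀ (by positivity) hHpos]
      calc 2 * C ^ 2 * (∑ c, Ec c) * (H : ℝ) ≤ 2 * C ^ 2 * (16 * (625 * (H : ℝ) ^ 4) * β ^ (2 * δ - 1)) * (H : ℝ) := by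
            gcongr
        _ = 20000 * C ^ 2 * β ^ (2 * δ - 1) * (H : ℝ) ^ 5 := by ring
    calc β * |Bt T - Bt 0| ≤ β * ((T : ℝ) * (2 * C ^ 2 * (∑ c, Ec c) / (H : ℝ) ^ 5)) :=
          mul_le_mul_of_nonneg_left htel hβ0.le
      _ ≤ β * ((T : ℝ) * (20000 * C ^ 2 * β ^ (2 * δ - 1) / (H : ℝ))) := by gcongr
      _ = 20000 * C ^ 2 * (β * β ^ (2 * δ - 1) * T / H) := by ring
  -- flatness of the Dirichlet variance
  have hflatT : |Vt T - Vt 0| ≤ KN / H := hN H hHH₀ (xt T) (xt 0) (hnear T le_rfl) (hnear 0 (Nat.zero_le _))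
  have hone : (1 : ℝ) ≤ β ^ (2 * δ) * T :=
    one_le_mul_of_one_le_of_one_le (Real.one_le_rpow hβ1 (by positivity : (0 : ℝ) ≤ 2 * δ)) hT1
  have hflat' : 3 / 2 * |Vt T - Vt 0| ≤ 3 / 2 * |KN| * (β ^ (2 * δ) * T / H) := by
    have h1 : KN / H ≤ |KN| / H := div_le_div_of_nonneg_right (le_abs_self KN) hHpos.le
    have h2 : |KN| / H ≤ |KN| * (β ^ (2 * δ) * T / H) := by
      rw [mul_div_assoc', div_le_div_iff_of_pos_right hHpos]
      exact le_mul_of_one_le_right (abs_nonneg KN) hone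
    have := hflatT.trans (h1.trans h2)
    linarith
  -- the two expansion errors
  have herr : 2 * β ^ (-θ) ≤ 4 * (β ^ (2 * δ) * T / H) := by
    have h1 : β ^ (-θ) * (H : ℝ) ≤ 2 := by
      calc β ^ (-θ) * (H : ℝ) ≤ β ^ (-θ) * (2 * β ^ θ) := mul_le_mul_of_nonneg_left hH2 (Real.rpow_nonneg hβ0.le _)
        _ = 2 * (β ^ (-θ) * β ^ θ) := by ring
        _ = 2 := by rw [← Real.rpow_add hβ0, neg_add_cancel, Real.rpow_zero, mul_one]
    rw [mul_div_assoc', le_div_iff₀ hHpos]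
    calc 2 * β ^ (-θ) * (H : ℝ) = 2 * (β ^ (-θ) * (H : ℝ)) := by ring
      _ ≤ 2 * 2 := by linarith
      _ ≤ 4 * (β ^ (2 * δ) * T) := by linarith
  -- assemble
  have hmain : β * |Em T - Em 0| ≤ (4 + 3 / 2 * |KN| + 20000 * C ^ 2) * (β ^ (2 * δ) * T / H) := by
    have e1 := hexp_t T le_rfl
    have e0 := hexp_t 0 (Nat.zero_le _)
    have hsplit : β * (Em T - Em 0) = (β * Em T - 3 / 2 * Vt T - β * Bt T) - (β * Em 0 - 3 / 2 * Vt 0 - β * Bt 0) +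
        3 / 2 * (Vt T - Vt 0) + β * (Bt T - Bt 0) := by ring
    have habs : β * |Em T - Em 0| = |β * (Em T - Em 0)| := by rw [abs_mul, abs_of_pos hβ0]
    rw [habs, hsplit]
    have hβB : |β * (Bt T - Bt 0)| = β * |Bt T - Bt 0| := by rw [abs_mul, abs_of_pos hβ0]
    have h32 : |3 / 2 * (Vt T - Vt 0)| = 3 / 2 * |Vt T - Vt 0| := by rw [abs_mul, abs_of_pos (by norm_num : (0 : ℝ) < 3 / 2)]
    calc |β * Em T - 3 / 2 * Vt T - β * Bt T - (β * Em 0 - 3 / 2 * Vt 0 - β * Bt 0) + 3 / 2 * (Vt T - Vt 0) + β * (Bt T - Bt 0)|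
        ≤ |β * Em T - 3 / 2 * Vt T - β * Bt T - (β * Em 0 - 3 / 2 * Vt 0 - β * Bt 0) + 3 / 2 * (Vt T - Vt 0)| + |β * (Bt T - Bt 0)| :=
          abs_add_le _ _
      _ ≤ (|β * Em T - 3 / 2 * Vt T - β * Bt T - (β * Em 0 - 3 / 2 * Vt 0 - β * Bt 0)| + |3 / 2 * (Vt T - Vt 0)|) + |β * (Bt T - Bt 0)| := by
          gcongr; exact abs_add_le _ _
      _ ≤ ((|β * Em T - 3 / 2 * Vt T - β * Bt T| + |β * Em 0 - 3 / 2 * Vt 0 - β * Bt 0|) + |3 / 2 * (Vt T - Vt 0)|) + |β * (Bt T - Bt 0)| := by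
          gcongr; exact abs_sub _ _
      _ ≤ ((β ^ (-θ) + β ^ (-θ)) + 3 / 2 * |KN| * (β ^ (2 * δ) * T / H)) + 20000 * C ^ 2 * (β ^ (2 * δ) * T / H) := by
          rw [hβB, h32]; gcongr
      _ ≤ (4 + 3 / 2 * |KN| + 20000 * C ^ 2) * (β ^ (2 * δ) * T / H) := by linarith [herr, hflat', hback]
  -- conclude: divide by β
  have hgoal : |Em T - Em 0| ≤ (4 + 3 / 2 * |KN| + 20000 * C ^ 2) * β ^ (2 * δ - 1) * (T : ℝ) / (H : ℝ) := by
    have h2δ : β ^ (2 * δ) = β * β ^ (2 * δ - 1) := by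
      rw [show 2 * δ = 1 + (2 * δ - 1) by ring, Real.rpow_add hβ0, Real.rpow_one]; ring_nf
    rw [h2δ] at hmain
    have : β * |Em T - Em 0| ≤ β * ((4 + 3 / 2 * |KN| + 20000 * C ^ 2) * β ^ (2 * δ - 1) * (T : ℝ) / (H : ℝ)) := by
      calc β * |Em T - Em 0| ≤ _ := hmain
        _ = β * ((4 + 3 / 2 * |KN| + 20000 * C ^ 2) * β ^ (2 * δ - 1) * (T : ℝ) / (H : ℝ)) := by ring
    exact le_of_mul_le_mul_left this hβ0
  -- match the statement of `GoodBoundaryMeanSmooth`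
  have hx0 : xt 0 = boxCentre H := by rw [hxt]; simp
  have hEm0 : Em 0 = ∫ U, plaqCostAt (fundamentalRep (Fin 2)) (boxCentre H) 1 2 U ∂(boxKernel β H ω) := by
    rw [hEm]; simp only [hx0]
  have hEmT : Em T = ∫ U, plaqCostAt (fundamentalRep (Fin 2)) (boxCentre H + Pi.single 0 (T : ℤ)) 1 2 U ∂(boxKernel β H ω) := by
    rw [hEm]
  rw [hEm0, hEmT] at hgoal
  simpa only [hHdef, hTdef, hδ, hA] using hgoal


/-- **L1b ⇐ `KernelMeanExpansion` ∧ `DirKernelDiagFlat`** (the NAMED interfaces of `Theorems/WeakCouplingRatesBulkDominatesColdBoxWDefs.lean`,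
appended 2026-08-26): the registered stub `stub_goodBoundaryMeanSmooth` of the line `dlr-chessboard` follows from the two sub-stubs
«one-scale kernel mean expansion along `δ = θ/5` below a ceiling» and «flat Dirichlet variance near the centre». -/
theorem goodBoundaryMeanSmooth_of_kernelMeanExpansion
    (hexp : ∃ θ₂ : ℝ, 0 < θ₂ ∧ ∀ θ : ℝ, 0 < θ → θ ≤ θ₂ → KernelMeanExpansion θ (θ / 5))
    (hflat : DirKernelDiagFlat) :
    ∃ θ₁ : ℝ, 0 < θ₁ ∧ ∀ θ : ℝ, 0 < θ → θ ≤ θ₁ → GoodBoundaryMeanSmooth (θ / 20) θ (θ / 5) := by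
  obtain ⟨θ₂, hθ₂, h⟩ := hexp
  unfold KernelMeanExpansion at h
  unfold DirKernelDiagFlat at hflat
  exact goodBoundaryMeanSmooth_of_expansion_explicit hθ₂ h hflat

end Summit.QuantumFields.YangMills.Theorems.WeakCouplingRates

end
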